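import Literature.Analysis.Matrix.KalmanYakubovichPopovLemma
import HarnessLib

/-!
# The strict KYP lemma in discrete time (unit circle), real data — by Cayley transform

Topic `Literature/Analysis/Matrix`, namespace `Literature.Analysis.Matrix.KalmanYakubovichPopovLemmaDiscrete`.
Everything is PROVED (no definition, no named fact, no `sorry`; standard axioms).

## Source (read on the page)

A. Megretski, *KYP lemma for non-strict inequalities and the associated minimax theorem*,
arXiv:1008.2552 (2010) [Megretski2010] (held text `paper:arxiv-1008.2552`, chunk p0003 L129–155),
§1.1.3 «Strict Linear Matrix Inequalities», verbatim (label `thm:kyplmisdt`):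
«For arbitrary matrices `A ∈ ℂ^{n,n}`, `B ∈ ℂ^{n,m}`, `Q = Q' ∈ ℂ^{n+m,n+m}` the following conditions
are equivalent: (a) there exists `P = P' ∈ ℂ^{n,n}` such that the Hermitian form
`σ_P(x,u) = σ(x,u) + x'Px − (Ax+Bu)'P(Ax+Bu)` is positive definite; (b) the Hermitian form `σ` is
positive definite on the subspace `L(z) = {(x,u) ∈ ℂⁿ × ℂᵐ : zx = Ax + Bu}` for all `z ∈ 𝕋`.
Moreover, when matrices `A, B, Q` in (b) are real, the corresponding matrix `P` from (a) can be
chosen to be real as well.»  (`𝕋` = the unit circle; `σ(x,u) = (x;u)'Q(x;u)`.)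

## What is typed (all proved) — the REAL-data case under `det(A + I) ≠ 0`

* **`strictKYP_discrete_iff`** — for real `A, B`, symmetric `Q`, and `A + I` invertible:
  `(∃ P real symmetric, Q + [AᵀPA − P, AᵀPB; BᵀPA, BᵀPB] ≻ 0) ⟺
   (∀ z ∈ ℂ, |z| = 1, ∀ (x,u) ≠ 0 with Ax + Bu = zx: Re (x;u)ᴴQ(x;u) > 0)`.
  Since `P` ranges over all symmetric matrices, the sign in front of the `P`-terms is immaterial
  (the text's `x'Px − (Ax+Bu)'P(Ax+Bu)` is ours at `−P`); `strictKYP_discrete_neg_iff` is the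
  `≺ 0` form.
* PROOF (not the text's, which runs the Hahn–Banach/alignment argument of §3.2.4 directly in
  discrete time): the Cayley substitution `x̃ = (A+I)x + Bu = g + x` (`g = Ax + Bu`),
  `Ã = (A−I)(A+I)⁻¹`, `B̃ = 2(A+I)⁻¹B`, under which `Ãx̃ + B̃u = g − x` (`cayley_mulVec`), the
  continuous-time KYP form `2x̃ᵀP(Ãx̃ + B̃u)` equals `2((g)ᵀPg − xᵀPx)` (`cayley_form`), and
  `g − x = iω(g + x)` iff `g = zx` with `z = (1 + iω)/(1 − iω)` on the unit circle minus `{−1}`,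
  the point `z = −1` corresponding to the continuous-time clause `L(∞)`; then the tree's
  continuous-time theorem `KalmanYakubovichPopovLemma.strictKYP_iff` (Megretski `thm:kyplmisct`).

NOT typed: complex data; the case `−1 ∈ σ(A)` of the printed theorem (our hypothesis
`IsUnit (A + 1).det` is an artefact of the real Cayley transform —
TODO(general form): remove it, e.g. by the text's direct discrete-time alignment); non-strict
versions.
-/

noncomputable section

open Matrix Finset Complex
open scoped BigOperators ComplexOrder

namespace Literature.Analysis.Matrix.KalmanYakubovichPopovLemmaDiscrete

open Literature.Analysis.Matrix.KalmanYakubovichPopovLemma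

/-! ## §1 Generic identities: the discrete-time block form and the Cayley substitution -/

section Generic

variable {R : Type*} [CommRing R]
variable {n m : Type*} [Fintype n] [Fintype m] [DecidableEq n]

/-- `x̃ = (A+I)x + Bu = (Ax + Bu) + x`. [folklore] -/
private theorem cayley_state (A : Matrix n n R) (B : Matrix n m R) (x : n → R) (u : m → R) :
    (A + 1) *ᵥ x + B *ᵥ u = (A *ᵥ x + B *ᵥ u) + x := by
  rw [add_mulVec, one_mulVec]
  abel

/-- The Cayley substitution: with `S = (A+I)⁻¹`, `x̃ = (A+I)x + Bu`, `Ã = (A−I)S`, `B̃ = S(B+B)`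
one has `Ãx̃ + B̃u = (Ax + Bu) − x`. [folklore] -/
private theorem cayley_mulVec (A S : Matrix n n R) (B : Matrix n m R) (hSA : S * (A + 1) = 1)
    (hAS : (A + 1) * S = 1) (x : n → R) (u : m → R) :
    ((A - 1) * S) *ᵥ ((A + 1) *ᵥ x + B *ᵥ u) + (S * (B + B)) *ᵥ u = (A *ᵥ x + B *ᵥ u) - x := by
  set w : n → R := S *ᵥ (B *ᵥ u) with hw
  have hw' : A *ᵥ w + w = B *ᵥ u := by
    have h1 : (A + 1) *ᵥ w = B *ᵥ u := by rw [hw, mulVec_mulVec, hAS, one_mulVec]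
    rwa [add_mulVec, one_mulVec] at h1
  have e1 : ((A - 1) * S) *ᵥ ((A + 1) *ᵥ x) = A *ᵥ x - x := by
    rw [← mulVec_mulVec, mulVec_mulVec x S (A + 1), hSA, one_mulVec, sub_mulVec, one_mulVec]
  have e2 : ((A - 1) * S) *ᵥ (B *ᵥ u) = A *ᵥ w - w := by
    rw [← mulVec_mulVec, ← hw, sub_mulVec, one_mulVec]
  have e3 : (S * (B + B)) *ᵥ u = w + w := by
    rw [← mulVec_mulVec, add_mulVec, mulVec_add, ← hw]
  rw [mulVec_add, e1, e2, e3, ← hw']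
  abel

/-- `T(x̃; u) = (x; u)` for `T = [S, −SB; 0, I]`, `S(A+I) = I`, `x̃ = (A+I)x + Bu`. [folklore] -/
private theorem cayley_T_mulVec (A S : Matrix n n R) (B : Matrix n m R)
    (hSA : S * (A + 1) = 1) (x : n → R) (u : m → R) [DecidableEq m] :
    fromBlocks S (-(S * B)) 0 (1 : Matrix m m R) *ᵥ Sum.elim ((A + 1) *ᵥ x + B *ᵥ u) u =
      Sum.elim x u := by
  simp only [fromBlocks_mulVec, Sum.elim_comp_inl, Sum.elim_comp_inr, zero_mulVec, zero_add,
    one_mulVec, mulVec_add, neg_mulVec, ← mulVec_mulVec]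
  rw [mulVec_mulVec x S (A + 1), hSA, one_mulVec]
  congr 1
  abel

variable [StarRing R]

omit [DecidableEq n] in
/-- `vᴴ(TᴴQT)v = (Tv)ᴴQ(Tv)`. [folklore] -/
private theorem star_dotProduct_conjTranspose_mul_mul_mulVec {k : Type*} [Fintype k] (T Q : Matrix k k R)
    (v : k → R) : star v ⬝ᵥ ((Tᴴ * Q * T) *ᵥ v) = star (T *ᵥ v) ⬝ᵥ (Q *ᵥ (T *ᵥ v)) := by
  rw [← mulVec_mulVec, ← mulVec_mulVec, dotProduct_mulVec (star v) Tᴴ, vecMul_conjTranspose,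
    star_star]

omit [DecidableEq n] in
/-- The discrete-time KYP form: `(x;u)ᴴ [AᴴPA − P, AᴴPB; BᴴPA, BᴴPB] (x;u) =
(Ax+Bu)ᴴP(Ax+Bu) − xᴴPx`. [cite: Megretski2010, §1.1.3 (k5) («`σ_P(x,u) = σ(x,u) + x'Px − (Ax+Bu)'P(Ax+Bu)`», at `−P`)] -/
theorem star_dotProduct_dkyp_mulVec (A : Matrix n n R) (B : Matrix n m R) (P : Matrix n n R)
    (x : n → R) (u : m → R) :
    star (Sum.elim x u) ⬝ᵥ
        (fromBlocks (Aᴴ * P * A - P) (Aᴴ * P * B) (Bᴴ * P * A) (Bᴴ * P * B) *ᵥ Sum.elim x u) =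
      star (A *ᵥ x + B *ᵥ u) ⬝ᵥ (P *ᵥ (A *ᵥ x + B *ᵥ u)) - star x ⬝ᵥ (P *ᵥ x) := by
  have hs : star (Sum.elim x u) = Sum.elim (star x) (star u) := by
    funext i
    cases i <;> rfl
  have h1 : ∀ y : n → R, star x ⬝ᵥ (Aᴴ *ᵥ y) = star (A *ᵥ x) ⬝ᵥ y := fun y => by
    rw [dotProduct_mulVec, vecMul_conjTranspose, star_star]
  have h2 : ∀ y : n → R, star u ⬝ᵥ (Bᴴ *ᵥ y) = star (B *ᵥ u) ⬝ᵥ y := fun y => by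
    rw [dotProduct_mulVec, vecMul_conjTranspose, star_star]
  rw [hs, fromBlocks_mulVec, Sum.elim_comp_inl, Sum.elim_comp_inr, sumElim_dotProduct_sumElim]
  simp only [sub_mulVec, ← mulVec_mulVec, dotProduct_add, dotProduct_sub, h1, h2, star_add,
    add_dotProduct, mulVec_add]
  abel

end Generic

/-! ## §2 Real data: symmetry, scaling, and the Cayley identity of the two KYP forms -/

section Real

variable {n m : Type*} [Fintype n] [Fintype m] [DecidableEq n] [DecidableEq m]

omit [Fintype m] [DecidableEq n] [DecidableEq m] in
/-- The discrete-time block `[AᵀPA − P, AᵀPB; BᵀPA, BᵀPB]` (matrix of `σ_P − σ` at `−P`) is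
symmetric for symmetric `P`. [cite: Megretski2010, §1.1.3 (k5)] -/
theorem dkyp_transpose (A : Matrix n n ℝ) (B : Matrix n m ℝ) {P : Matrix n n ℝ} (hP : Pᵀ = P) :
    (fromBlocks (Aᵀ * P * A - P) (Aᵀ * P * B) (Bᵀ * P * A) (Bᵀ * P * B))ᵀ =
      fromBlocks (Aᵀ * P * A - P) (Aᵀ * P * B) (Bᵀ * P * A) (Bᵀ * P * B) := by
  simp only [fromBlocks_transpose, transpose_sub, transpose_mul, transpose_transpose, hP,
    Matrix.mul_assoc]

omit [Fintype m] [DecidableEq n] [DecidableEq m] in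
/-- The discrete-time block `[AᵀPA − P, AᵀPB; BᵀPA, BᵀPB]` is linear in `P` (scalars).
[cite: Megretski2010, §1.1.3 (k5)] -/
theorem dkyp_smul (A : Matrix n n ℝ) (B : Matrix n m ℝ) (c : ℝ) (P : Matrix n n ℝ) :
    fromBlocks (Aᵀ * (c • P) * A - c • P) (Aᵀ * (c • P) * B) (Bᵀ * (c • P) * A)
        (Bᵀ * (c • P) * B) =
      c • fromBlocks (Aᵀ * P * A - P) (Aᵀ * P * B) (Bᵀ * P * A) (Bᵀ * P * B) := by
  simp only [Matrix.mul_smul, Matrix.smul_mul, fromBlocks_smul, smul_sub]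

omit [DecidableEq m] in
/-- **The Cayley identity of the two KYP forms**: with `S = (A+I)⁻¹`, `Ã = (A−I)S`, `B̃ = S(B+B)`
and `x̃ = (A+I)x + Bu`, the continuous-time form `(x̃;u)ᵀ[ÃᵀP + PÃ, PB̃; B̃ᵀP, 0](x̃;u)` equals
twice the discrete-time form `(x;u)ᵀ[AᵀPA − P, AᵀPB; BᵀPA, BᵀPB](x;u)`. [folklore] -/
private theorem cayley_form (A S P : Matrix n n ℝ) (B : Matrix n m ℝ) (hSA : S * (A + 1) = 1)
    (hAS : (A + 1) * S = 1) (hP : Pᵀ = P) (x : n → ℝ) (u : m → ℝ) :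
    Sum.elim ((A + 1) *ᵥ x + B *ᵥ u) u ⬝ᵥ
        (fromBlocks (((A - 1) * S)ᵀ * P + P * ((A - 1) * S)) (P * (S * (B + B)))
            ((S * (B + B))ᵀ * P) 0 *ᵥ Sum.elim ((A + 1) *ᵥ x + B *ᵥ u) u) =
      2 * (Sum.elim x u ⬝ᵥ
        (fromBlocks (Aᵀ * P * A - P) (Aᵀ * P * B) (Bᵀ * P * A) (Bᵀ * P * B) *ᵥ Sum.elim x u)) := by
  have h1 := star_dotProduct_kyp_mulVec ((A - 1) * S) (S * (B + B)) P ((A + 1) *ᵥ x + B *ᵥ u) u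
  have h2 := star_dotProduct_dkyp_mulVec A B P x u
  simp only [conjTranspose_eq_transpose_of_trivial, star_trivial] at h1 h2
  rw [h1, h2, cayley_mulVec A S B hSA hAS, cayley_state A B]
  have hsym : ∀ a b : n → ℝ, a ⬝ᵥ (P *ᵥ b) = b ⬝ᵥ (P *ᵥ a) := fun a b => by
    rw [dotProduct_mulVec, ← mulVec_transpose, hP, dotProduct_comm]
  simp only [mulVec_add, mulVec_sub, dotProduct_add, dotProduct_sub, add_dotProduct,
    sub_dotProduct]
  rw [hsym x (A *ᵥ x), hsym x (B *ᵥ u)]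
  ring

omit [Fintype n] [DecidableEq n] [DecidableEq m] in
/-- A real symmetric matrix whose quadratic form is the pull-back of a positive definite form
along a map with trivial kernel is positive definite. [folklore] -/
private theorem posDef_of_forms {k : Type*} [Fintype k] [Fintype n] {M : Matrix k k ℝ}
    {N : Matrix n n ℝ} (hM : M.PosDef) (hN : Nᵀ = N) (φ : (n → ℝ) → (k → ℝ))
    (hφ : ∀ v, v ≠ 0 → φ v ≠ 0) (hform : ∀ v, φ v ⬝ᵥ (M *ᵥ φ v) = v ⬝ᵥ (N *ᵥ v)) :
    N.PosDef := by
  refine PosDef.of_dotProduct_mulVec_pos ?_ fun v hv => ?_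
  · rw [IsHermitian, conjTranspose_eq_transpose_of_trivial, hN]
  · have h := hM.dotProduct_mulVec_pos (hφ v hv)
    rw [star_trivial, hform v] at h
    rwa [star_trivial]

omit [Fintype n] [Fintype m] [DecidableEq n] [DecidableEq m] in
/-- `Sum.elim x u = 0 ↔ x = 0 ∧ u = 0`. [folklore] -/
private theorem sumElim_eq_zero_iff {α : Type*} [Zero α] (x : n → α) (u : m → α) :
    Sum.elim x u = 0 ↔ x = 0 ∧ u = 0 := by
  constructor
  · intro h
    exact ⟨by funext i; exact congrFun h (Sum.inl i), by funext i; exact congrFun h (Sum.inr i)⟩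
  · rintro ⟨rfl, rfl⟩
    funext i
    cases i <;> rfl

end Real

/-! ## §3 The frequency side of the Cayley transform (over `ℂ`) -/

section Freq

variable {n m : Type*} [Fintype n] [Fintype m] [DecidableEq n] [DecidableEq m]

/-- On the unit circle minus `−1`: `ω = Im z / (1 + Re z)` has `iω(z + 1) = z − 1`. [folklore] -/
private theorem cayley_point {z : ℂ} (hz : ‖z‖ = 1) (hz1 : z ≠ -1) :
    (((z.im / (1 + z.re) : ℝ) : ℂ) * I) * (z + 1) = z - 1 := by
  have h1 : z.re * z.re + z.im * z.im = 1 := by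
    have h := Complex.normSq_eq_norm_sq z
    rw [hz, one_pow, Complex.normSq_apply] at h
    exact h
  have hre : 1 + z.re ≠ 0 := by
    intro h
    have hr : z.re = -1 := by linarith
    have hi : z.im = 0 := by nlinarith
    exact hz1 (Complex.ext (by simp [hr]) (by simp [hi]))
  apply Complex.ext
  · simp only [Complex.mul_re, Complex.mul_im, Complex.ofReal_re, Complex.ofReal_im, Complex.I_re,
      Complex.I_im, Complex.add_re, Complex.one_re, Complex.add_im, Complex.one_im,
      Complex.sub_re]
    field_simp
    nlinarith
  · simp only [Complex.mul_re, Complex.mul_im, Complex.ofReal_re, Complex.ofReal_im, Complex.I_re,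
      Complex.I_im, Complex.add_re, Complex.one_re, Complex.add_im, Complex.one_im,
      Complex.sub_im]
    field_simp
    ring

/-- From the imaginary axis to the circle: `z = (1 + iω)/(1 − iω)` has `|z| = 1`. [folklore] -/
private theorem norm_cayley_inv (ω : ℝ) :
    ((1 : ℂ) - ω * I) ≠ 0 ∧ ‖((1 : ℂ) - ω * I)⁻¹ * ((1 : ℂ) + ω * I)‖ = 1 := by
  have hc : (1 : ℂ) - ω * I ≠ 0 := by
    intro h
    have := congrArg Complex.re h
    simp at this
  refine ⟨hc, ?_⟩
  have hconj : starRingEnd ℂ ((1 : ℂ) + ω * I) = (1 : ℂ) - ω * I := by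
    simp only [map_add, map_one, map_mul, Complex.conj_ofReal, Complex.conj_I]
    ring
  rw [norm_mul, norm_inv, ← hconj, Complex.norm_conj, inv_mul_cancel₀]
  refine norm_ne_zero_iff.mpr fun h => ?_
  have := congrArg Complex.re h
  simp at this

/-- **The frequency side of the Cayley transform.**  For complex `A, S = (A+I)⁻¹, B, Q` and
`T = [S, −SB; 0, I]`: the continuous-time frequency condition for `(Ã, B̃, TᴴQT)` —
positivity of `TᴴQT` on every `L(iω)` and on `L(∞)` — is equivalent to positivity of `Q` on every
`L(z) = {(x,u) : Ax + Bu = zx}`, `|z| = 1` (the subspace families of the discrete- and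
continuous-time theorems correspond under the Cayley transform).
[cite: Megretski2010, §1.1.3 `thm:kyplmisdt` (b) (k6) and §1.2 `thm:kyplmisct` (b)] -/
theorem freq_cayley_iff (A S : Matrix n n ℂ) (B : Matrix n m ℂ) (Q : Matrix (n ⊕ m) (n ⊕ m) ℂ)
    (hSA : S * (A + 1) = 1) (hAS : (A + 1) * S = 1) :
    ((∀ (ω : ℝ) (y : n → ℂ) (u : m → ℂ),
          ((A - 1) * S) *ᵥ y + (S * (B + B)) *ᵥ u = ((ω : ℂ) * I) • y → Sum.elim y u ≠ 0 →
            0 < (star (Sum.elim y u) ⬝ᵥ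
              (((fromBlocks S (-(S * B)) 0 (1 : Matrix m m ℂ))ᴴ * Q *
                  fromBlocks S (-(S * B)) 0 (1 : Matrix m m ℂ)) *ᵥ Sum.elim y u)).re) ∧
        (∀ u : m → ℂ, u ≠ 0 →
          0 < (star (Sum.elim (0 : n → ℂ) u) ⬝ᵥ
            (((fromBlocks S (-(S * B)) 0 (1 : Matrix m m ℂ))ᴴ * Q *
                fromBlocks S (-(S * B)) 0 (1 : Matrix m m ℂ)) *ᵥ Sum.elim 0 u)).re)) ↔
      ∀ z : ℂ, ‖z‖ = 1 → ∀ (x : n → ℂ) (u : m → ℂ), A *ᵥ x + B *ᵥ u = z • x →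
        Sum.elim x u ≠ 0 → 0 < (star (Sum.elim x u) ⬝ᵥ (Q *ᵥ Sum.elim x u)).re := by
  set T : Matrix (n ⊕ m) (n ⊕ m) ℂ := fromBlocks S (-(S * B)) 0 1 with hT
  -- the form identity `(x̃;u)ᴴ TᴴQT (x̃;u) = (x;u)ᴴ Q (x;u)`
  have hformQ : ∀ (x : n → ℂ) (u : m → ℂ),
      star (Sum.elim ((A + 1) *ᵥ x + B *ᵥ u) u) ⬝ᵥ
          ((Tᴴ * Q * T) *ᵥ Sum.elim ((A + 1) *ᵥ x + B *ᵥ u) u) =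
        star (Sum.elim x u) ⬝ᵥ (Q *ᵥ Sum.elim x u) := by
    intro x u
    rw [star_dotProduct_conjTranspose_mul_mul_mulVec, hT, cayley_T_mulVec A S B hSA]
  -- every `x̃` is `(A+I)x + Bu`
  have hlift : ∀ (y : n → ℂ) (u : m → ℂ), (A + 1) *ᵥ (S *ᵥ (y - B *ᵥ u)) + B *ᵥ u = y :=
    fun y u => by rw [mulVec_mulVec, hAS, one_mulVec, sub_add_cancel]
  have hker : ∀ x : n → ℂ, (A + 1) *ᵥ x = 0 → x = 0 := fun x hx => by
    rw [← one_mulVec x, ← hSA, ← mulVec_mulVec, hx, mulVec_zero]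
  constructor
  · rintro ⟨hfin, hinf⟩ z hz x u hL hne
    have hxt : (A + 1) *ᵥ x + B *ᵥ u = (z + 1) • x := by
      rw [cayley_state, hL, add_smul, one_smul]
    by_cases hz1 : z = -1
    · -- the point `z = −1` ↔ `L(∞)`
      have hx0 : (A + 1) *ᵥ x + B *ᵥ u = 0 := by
        rw [hxt, hz1]
        norm_num
      have hu : u ≠ 0 := by
        intro hu
        apply hne
        have hx : x = 0 := hker x (by rwa [hu, mulVec_zero, add_zero] at hx0)
        rw [(sumElim_eq_zero_iff x u).mpr ⟨hx, hu⟩]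
      have h := hinf u hu
      have key := hformQ x u
      rw [hx0] at key
      rwa [key] at h
    · -- `z ≠ −1` ↔ `L(iω)`, `ω = Im z / (1 + Re z)`
      set ω : ℝ := z.im / (1 + z.re) with hω
      have hLc : ((A - 1) * S) *ᵥ ((A + 1) *ᵥ x + B *ᵥ u) + (S * (B + B)) *ᵥ u =
          ((ω : ℂ) * I) • ((A + 1) *ᵥ x + B *ᵥ u) := by
        rw [cayley_mulVec A S B hSA hAS, hxt, smul_smul, hω, cayley_point hz hz1, hL, sub_smul,
          one_smul]
      have hnec : Sum.elim ((A + 1) *ᵥ x + B *ᵥ u) u ≠ 0 := by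
        intro h0
        obtain ⟨h1, hu⟩ := (sumElim_eq_zero_iff _ _).mp h0
        apply hne
        rw [hxt] at h1
        have hz2 : z + 1 ≠ 0 := fun h => hz1 (eq_neg_of_add_eq_zero_left h)
        have hx : x = 0 := by
          rcases smul_eq_zero.mp h1 with h | h
          · exact absurd h hz2
          · exact h
        rw [(sumElim_eq_zero_iff x u).mpr ⟨hx, hu⟩]
      have h := hfin ω _ u hLc hnec
      rwa [hformQ x u] at h
  · intro hDT
    constructor
    · intro ω y u hL hne
      rw [← hlift y u] at hL hne ⊢
      rw [cayley_mulVec A S B hSA hAS, cayley_state] at hL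
      set x : n → ℂ := S *ᵥ (y - B *ᵥ u) with hx
      -- `g − x = iω(g + x)` ⇒ `g = z x`, `z = (1 + iω)/(1 − iω)`
      have key : ((1 : ℂ) - ω * I) • (A *ᵥ x + B *ᵥ u) = ((1 : ℂ) + ω * I) • x := by
        funext i
        have h := congrFun hL i
        simp only [Pi.sub_apply, Pi.add_apply, Pi.smul_apply, smul_eq_mul] at h ⊢
        linear_combination h
      obtain ⟨hc, hz⟩ := norm_cayley_inv ω
      have hLz : A *ᵥ x + B *ᵥ u = (((1 : ℂ) - ω * I)⁻¹ * ((1 : ℂ) + ω * I)) • x := by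
        have h := congrArg (fun w => ((1 : ℂ) - ω * I)⁻¹ • w) key
        simp only [smul_smul, inv_mul_cancel₀ hc, one_smul] at h
        exact h
      have hne' : Sum.elim x u ≠ 0 := by
        intro h0
        obtain ⟨hx0, hu⟩ := (sumElim_eq_zero_iff x u).mp h0
        apply hne
        rw [hx0, hu, mulVec_zero, mulVec_zero, add_zero]
        exact (sumElim_eq_zero_iff _ _).mpr ⟨rfl, rfl⟩
      have h := hDT _ hz x u hLz hne'
      rwa [← hformQ x u] at h
    · intro u hu
      set x : n → ℂ := -(S *ᵥ (B *ᵥ u)) with hx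
      have hxt : (A + 1) *ᵥ x + B *ᵥ u = 0 := by
        rw [hx, mulVec_neg, mulVec_mulVec, hAS, one_mulVec, neg_add_cancel]
      have hL : A *ᵥ x + B *ᵥ u = (-1 : ℂ) • x := by
        have h := hxt
        rw [cayley_state] at h
        rw [neg_one_smul]
        exact eq_neg_of_add_eq_zero_left h
      have hne : Sum.elim x u ≠ 0 := by
        intro h0
        exact hu ((sumElim_eq_zero_iff x u).mp h0).2
      have h := hDT (-1) (by simp) x u hL hne
      rwa [← hformQ x u, hxt] at h

end Freq

/-! ## §4 The theorem -/

section Main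

variable {n m : Type*} [Fintype n] [Fintype m] [DecidableEq n] [DecidableEq m]

/-- **The strict KYP lemma, discrete time (unit circle), real data** [special case `det(A+I) ≠ 0`
of Megretski's `thm:kyplmisdt`].  For real `A, B`, symmetric `Q`, with `A + I` invertible, the
following are equivalent:
(a) there is a real symmetric `P` with `Q + [AᵀPA − P, AᵀPB; BᵀPA, BᵀPB] ≻ 0`, i.e. the form
`σ(x,u) + (Ax+Bu)ᵀP(Ax+Bu) − xᵀPx` is positive definite;
(b) the Hermitian form `v ↦ vᴴQv` is positive definite on `L(z) = {(x,u) ∈ ℂⁿ × ℂᵐ : zx = Ax + Bu}`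
for every `z` on the unit circle.
[cite: Megretski2010, §1.1.3, strict-LMI discrete-time theorem (LaTeX label `thm:kyplmisdt`), incl. «when `A, B, Q` are real, `P` can be chosen real»; proof here by Cayley transform from the continuous-time theorem `thm:kyplmisct` (tree: `strictKYP_iff`)]
-- TODO(general form): the text has no hypothesis on `A`; `IsUnit (A + 1).det` comes from the
-- real Cayley transform used in this proof. -/
theorem strictKYP_discrete_iff (A : Matrix n n ℝ) (B : Matrix n m ℝ)
    {Q : Matrix (n ⊕ m) (n ⊕ m) ℝ} (hQ : Qᵀ = Q) (hA : IsUnit (A + 1).det) :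
    (∃ P : Matrix n n ℝ, Pᵀ = P ∧
        (Q + fromBlocks (Aᵀ * P * A - P) (Aᵀ * P * B) (Bᵀ * P * A) (Bᵀ * P * B)).PosDef) ↔
      ∀ z : ℂ, ‖z‖ = 1 → ∀ (x : n → ℂ) (u : m → ℂ),
        A.map Complex.ofRealHom *ᵥ x + B.map Complex.ofRealHom *ᵥ u = z • x →
          Sum.elim x u ≠ 0 →
            0 < (star (Sum.elim x u) ⬝ᵥ (Q.map Complex.ofRealHom *ᵥ Sum.elim x u)).re := by
  -- Cayley data
  set S : Matrix n n ℝ := (A + 1)⁻¹ with hSdef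
  have hAS : (A + 1) * S = 1 := mul_nonsing_inv _ hA
  have hSA : S * (A + 1) = 1 := nonsing_inv_mul _ hA
  set T : Matrix (n ⊕ m) (n ⊕ m) ℝ := fromBlocks S (-(S * B)) 0 1 with hTdef
  set Qt : Matrix (n ⊕ m) (n ⊕ m) ℝ := Tᵀ * Q * T with hQtdef
  have hQt : Qtᵀ = Qt := by
    rw [hQtdef, transpose_mul, transpose_mul, transpose_transpose, hQ, Matrix.mul_assoc]
  have hformQ : ∀ (x : n → ℝ) (u : m → ℝ),
      Sum.elim ((A + 1) *ᵥ x + B *ᵥ u) u ⬝ᵥ (Qt *ᵥ Sum.elim ((A + 1) *ᵥ x + B *ᵥ u) u) =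
        Sum.elim x u ⬝ᵥ (Q *ᵥ Sum.elim x u) := by
    intro x u
    have h := star_dotProduct_conjTranspose_mul_mul_mulVec T Q (Sum.elim ((A + 1) *ᵥ x + B *ᵥ u) u)
    simp only [conjTranspose_eq_transpose_of_trivial, star_trivial] at h
    rw [hQtdef, h, hTdef, cayley_T_mulVec A S B hSA]
  have hlift : ∀ (y : n → ℝ) (u : m → ℝ), (A + 1) *ᵥ (S *ᵥ (y - B *ᵥ u)) + B *ᵥ u = y :=
    fun y u => by rw [mulVec_mulVec, hAS, one_mulVec, sub_add_cancel]
  have hker : ∀ x : n → ℝ, (A + 1) *ᵥ x = 0 → x = 0 := fun x hx => by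
    rw [← one_mulVec x, ← hSA, ← mulVec_mulVec, hx, mulVec_zero]
  -- Step 1: the LMI side — same `P` up to the factor `2`
  have hLMI : (∃ P : Matrix n n ℝ, Pᵀ = P ∧
        (Q + fromBlocks (Aᵀ * P * A - P) (Aᵀ * P * B) (Bᵀ * P * A) (Bᵀ * P * B)).PosDef) ↔
      (∃ P : Matrix n n ℝ, Pᵀ = P ∧
        (Qt + fromBlocks (((A - 1) * S)ᵀ * P + P * ((A - 1) * S)) (P * (S * (B + B)))
          ((S * (B + B))ᵀ * P) 0).PosDef) := by
    constructor
    · rintro ⟨P, hP, hM⟩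
      have hP2 : ((1 / 2 : ℝ) • P)ᵀ = (1 / 2 : ℝ) • P := by rw [transpose_smul, hP]
      -- every `ỹ` is `((A+I)x + Bu; u)` with `x = S(ỹ₁ − Bỹ₂)`, `u = ỹ₂`
      have hpar : ∀ y : n ⊕ m → ℝ, y = Sum.elim ((A + 1) *ᵥ (S *ᵥ (y ∘ Sum.inl - B *ᵥ (y ∘ Sum.inr)))
          + B *ᵥ (y ∘ Sum.inr)) (y ∘ Sum.inr) := fun y => by
        rw [hlift, Sum.elim_comp_inl_inr]
      refine ⟨(1 / 2 : ℝ) • P, hP2, posDef_of_forms hM ?_ (fun y => T *ᵥ y) ?_ ?_⟩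
      · rw [transpose_add, hQt, kyp_transpose _ _ hP2]
      · intro y hy h0
        apply hy
        rw [hpar y, hTdef, cayley_T_mulVec A S B hSA] at h0
        obtain ⟨hx, hu⟩ := (sumElim_eq_zero_iff _ _).mp h0
        rw [hpar y, hx, hu, mulVec_zero, mulVec_zero, add_zero]
        exact (sumElim_eq_zero_iff _ _).mpr ⟨rfl, rfl⟩
      · intro y
        rw [hpar y, hTdef, cayley_T_mulVec A S B hSA]
        rw [add_mulVec Q, dotProduct_add, add_mulVec Qt, dotProduct_add, hformQ,
          cayley_form A S _ B hSA hAS hP2, dkyp_smul, smul_mulVec, dotProduct_smul,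
          smul_eq_mul]
        ring
    · rintro ⟨P, hP, hN⟩
      have hP2 : ((2 : ℝ) • P)ᵀ = (2 : ℝ) • P := by rw [transpose_smul, hP]
      refine ⟨(2 : ℝ) • P, hP2, posDef_of_forms hN ?_
        (fun v => Sum.elim ((A + 1) *ᵥ (v ∘ Sum.inl) + B *ᵥ (v ∘ Sum.inr)) (v ∘ Sum.inr)) ?_ ?_⟩
      · rw [transpose_add, hQ, dkyp_transpose _ _ hP2]
      · intro v hv h0
        apply hv
        obtain ⟨hx, hu⟩ := (sumElim_eq_zero_iff _ _).mp h0
        rw [hu, mulVec_zero, add_zero] at hx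
        rw [← Sum.elim_comp_inl_inr v]
        exact (sumElim_eq_zero_iff _ _).mpr ⟨hker _ hx, hu⟩
      · intro v
        conv_rhs => rw [← Sum.elim_comp_inl_inr v]
        rw [add_mulVec Qt, dotProduct_add, add_mulVec Q, dotProduct_add, hformQ,
          cayley_form A S P B hSA hAS hP, dkyp_smul, smul_mulVec, dotProduct_smul,
          smul_eq_mul]
  rw [hLMI, strictKYP_iff ((A - 1) * S) (S * (B + B)) hQt]
  -- Step 2: the frequency side — transport the Cayley data to `ℂ` and use `freq_cayley_iff`
  have hc : ∀ M : Matrix (n ⊕ m) (n ⊕ m) ℝ,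
      (Mᵀ).map Complex.ofRealHom = (M.map Complex.ofRealHom)ᴴ := fun M => by
    rw [← conjTranspose_eq_transpose_of_trivial]
    exact Matrix.conjTranspose_map _ (fun a => by simp)
  have hAS' : (A.map Complex.ofRealHom + 1) * S.map Complex.ofRealHom = 1 := by
    have h := congrArg (fun M : Matrix n n ℝ => M.map Complex.ofRealHom) hAS
    simp only [Matrix.map_mul, Matrix.map_add _ (map_add Complex.ofRealHom),
      Matrix.map_one _ (map_zero Complex.ofRealHom) (map_one Complex.ofRealHom)] at h
    exact h
  have hSA' : S.map Complex.ofRealHom * (A.map Complex.ofRealHom + 1) = 1 := by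
    have h := congrArg (fun M : Matrix n n ℝ => M.map Complex.ofRealHom) hSA
    simp only [Matrix.map_mul, Matrix.map_add _ (map_add Complex.ofRealHom),
      Matrix.map_one _ (map_zero Complex.ofRealHom) (map_one Complex.ofRealHom)] at h
    exact h
  have hAt : ((A - 1) * S).map Complex.ofRealHom =
      (A.map Complex.ofRealHom - 1) * S.map Complex.ofRealHom := by
    rw [Matrix.map_mul, Matrix.map_sub _ (map_sub Complex.ofRealHom),
      Matrix.map_one _ (map_zero Complex.ofRealHom) (map_one Complex.ofRealHom)]
  have hBt : (S * (B + B)).map Complex.ofRealHom =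
      S.map Complex.ofRealHom * (B.map Complex.ofRealHom + B.map Complex.ofRealHom) := by
    rw [Matrix.map_mul, Matrix.map_add _ (map_add Complex.ofRealHom)]
  have hTt : T.map Complex.ofRealHom =
      fromBlocks (S.map Complex.ofRealHom) (-(S.map Complex.ofRealHom * B.map Complex.ofRealHom))
        0 (1 : Matrix m m ℂ) := by
    rw [hTdef, fromBlocks_map, Matrix.map_neg _ (map_neg Complex.ofRealHom), Matrix.map_mul,
      Matrix.map_zero _ (map_zero Complex.ofRealHom),
      Matrix.map_one _ (map_zero Complex.ofRealHom) (map_one Complex.ofRealHom)]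
  have hQt' : Qt.map Complex.ofRealHom =
      (T.map Complex.ofRealHom)ᴴ * Q.map Complex.ofRealHom * T.map Complex.ofRealHom := by
    rw [hQtdef, Matrix.map_mul, Matrix.map_mul, hc]
  rw [hAt, hBt, hQt', hTt]
  exact freq_cayley_iff _ _ _ _ hSA' hAS'

omit [Fintype m] [DecidableEq n] [DecidableEq m] in
/-- `[Aᵀ(−P)A − (−P), …] = −[AᵀPA − P, …]` (the text's sign convention `x'Px − (Ax+Bu)'P(Ax+Bu)`
versus ours). [cite: Megretski2010, §1.1.3 (k5)] -/
theorem dkyp_neg (A : Matrix n n ℝ) (B : Matrix n m ℝ) (P : Matrix n n ℝ) :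
    fromBlocks (Aᵀ * (-P) * A - -P) (Aᵀ * (-P) * B) (Bᵀ * (-P) * A) (Bᵀ * (-P) * B) =
      -fromBlocks (Aᵀ * P * A - P) (Aᵀ * P * B) (Bᵀ * P * A) (Bᵀ * P * B) := by
  rw [← neg_one_smul ℝ P, dkyp_smul, neg_one_smul]

/-- **The strict discrete-time KYP lemma, `≺ 0` form.**  For real `A, B`, symmetric `Q`, `A + I`
invertible: there is a real symmetric `P` with `Q + [AᵀPA − P, AᵀPB; BᵀPA, BᵀPB] ≺ 0` iff
`Re (x;u)ᴴQ(x;u) < 0` for all `(x,u) ≠ 0` with `Ax + Bu = zx`, `|z| = 1`.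
[cite: Megretski2010, §1.1.3 `thm:kyplmisdt` (applied to `−Q`)] -/
theorem strictKYP_discrete_neg_iff (A : Matrix n n ℝ) (B : Matrix n m ℝ)
    {Q : Matrix (n ⊕ m) (n ⊕ m) ℝ} (hQ : Qᵀ = Q) (hA : IsUnit (A + 1).det) :
    (∃ P : Matrix n n ℝ, Pᵀ = P ∧
        (-(Q + fromBlocks (Aᵀ * P * A - P) (Aᵀ * P * B) (Bᵀ * P * A) (Bᵀ * P * B))).PosDef) ↔
      ∀ z : ℂ, ‖z‖ = 1 → ∀ (x : n → ℂ) (u : m → ℂ),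
        A.map Complex.ofRealHom *ᵥ x + B.map Complex.ofRealHom *ᵥ u = z • x →
          Sum.elim x u ≠ 0 →
            (star (Sum.elim x u) ⬝ᵥ (Q.map Complex.ofRealHom *ᵥ Sum.elim x u)).re < 0 := by
  have hnegQ : (-Q)ᵀ = -Q := by rw [transpose_neg, hQ]
  have key := strictKYP_discrete_iff A B hnegQ hA
  have hform : ∀ v : n ⊕ m → ℂ, (star v ⬝ᵥ ((-Q).map Complex.ofRealHom *ᵥ v)).re =
      -(star v ⬝ᵥ (Q.map Complex.ofRealHom *ᵥ v)).re := by
    intro v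
    rw [Matrix.map_neg _ (map_neg Complex.ofRealHom), neg_mulVec, dotProduct_neg, Complex.neg_re]
  simp only [hform, neg_pos] at key
  rw [← key]
  constructor
  · rintro ⟨P, hP, h⟩
    refine ⟨-P, by rw [transpose_neg, hP], ?_⟩
    rwa [dkyp_neg, ← neg_add]
  · rintro ⟨P, hP, h⟩
    refine ⟨-P, by rw [transpose_neg, hP], ?_⟩
    rwa [dkyp_neg, neg_add, neg_neg]

end Main

end Literature.Analysis.Matrix.KalmanYakubovichPopovLemmaDiscrete
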